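/-
Copyright (c) 2026 the pub-hodgecm-mathlib formalisation cell (harness21).  Prover seat hodgecm-mathlib-F0P3-p01 (g31), «(D-RAM) FOUR-FRAME» road of crux H413, line LH4, MS ROAD A,
STAGE B ∕ B9: the type-2 twin B5 (ii)₂ of ★ p855795 (LH4-p10 (g2)) «STABILITY READING ON THE GLUED STRATUM», at a general corner exponent.  2026-09-04.
-/
import Summits.HodgeConjecture.HodgeConjecture.Theorems.F0P3cDyRamDiagonalGluedStability   -- ★ p855795 (LH4-p10 (g2)): `mapGL_latt_hnf_glued_eq_iff`, `v_le_and_v_le_of_v_add_le_of_ne`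
import HarnessLib

/-!
# Crux `H413`, MS ROAD A, STAGE B ∕ B9 brick B5 (ii)₂: «STABILITY READING ON THE GLUED STRATUM — GENERAL CORNER» (type-0 and type-2 glued frames at once)

Cell `hodgecm-mathlib` (D-0151), FLOOR 0, crux item H413 = `stmt-HodgeConjecture-24833`; lane `--supports stmt-HodgeConjecture-24833 --as helper` (count-neutral).  THEOREMS ONLY
(no `def`, no instance, no notation, no `sorry`).  LH4-p10 (g2) MEMO v2.1 §T2.3 (`F0/P3c/LH4/LH4-p10/g2/MEMO-stableLaw-finite.v2.1-type2.LH4p10g2.md`): the TYPE-2 glued stratum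
`G₁(2ρ+1, s)` has frame `V = (1 0 0; x ϖ^ρ 0; xζ + y″  ϖ^ρζ  ϖ^{2ρ+1+s})` with units `x, ζ` and `|y″| = |ϖ|^s` — the corner exponent exceeds `2ρ + v(y″)` by ONE, unlike type 0
(★ p855795, corner `2ρ + s` with `|y″| = |ϖ|^s`).  ★ p855795's three congruences `mapGL_latt_hnf_glued_eq_iff` carry NO hypothesis on `y″`, so they serve every corner; this file
reads the DEPTH corollaries at the general corner `c = 2ρ + s + e` (`e = 0`: type 0, verbatim ★ p855795; `e = 1`: type 2):
* `mapGL_latt_hnf_glued_corner_eq_of_depths` — TUBE ⟹ STABLE, point-free: `2ρ + s + e ≤ n₁`, `2ρ + e ≤ n₂`, `ρ ≤ n₃` ⟹ every point is `T`-stable;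
* `depths_of_mapGL_latt_hnf_glued_corner_eq` — OFF THE GLUE FOOT (`n₁ ≠ n₂ + s`), STABLE ⟹ TUBE: `2ρ + s + e ≤ n₁ ∧ 2ρ + e ≤ n₂`;
* `mapGL_latt_hnf_glued_corner_eq_iff_of_foot` — ON THE GLUE FOOT (`n₁ = n₂ + s`): stable ⟺ `ρ ≤ n₃ ∧ |(β−1)xζ + (α−1)y″| ≤ |ϖ|^{2ρ+s+e}` (the (b)-congruence is implied by
  `n₁ = n₂ + s ≥ … ` only when `ρ + e ≤ n₂`; we keep it explicit: stable ⟺ `ρ ≤ n₃ ∧ ρ + s + e ≤ n₁ ∧ glue congruence`);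
and the type-2 letters (`e = 1`, corner written `2ρ + 1 + s` as in the B10₂ skeleton 08e5e6e2d02c47d3): `mapGL_latt_hnf_glued_typeTwo_eq_of_depths`,
`depths_of_mapGL_latt_hnf_glued_typeTwo_eq` (tube regime `2ρ + 1 + s ≤ n₁`, `2ρ + 1 ≤ n₂`, `ρ ≤ n₃` — MEMO §T2.3 «COUNT (tube, `r + s ≤ n₁`, `r ≤ min(n₂,n₃)`)», `r = 2ρ+1`).

HONEST LABEL.  Count-neutral (`--supports`); the census laws (MS) stay PROVER TARGETS until the Stage B ∕ B9 assemblies land; `HC_CM` is proved only modulo the 7 printed citations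
(2 remaining named inputs: hLiu418 = `stmt-HodgeConjecture-24832`, h413 = `stmt-HodgeConjecture-24833`) until rung 0 closes.

## References
* [Kottwitz1986BaseChangeUnits] R. E. Kottwitz, *Base change for unit elements of Hecke algebras*, Compositio Math. 60 (1986), §1 pp. 240–241 (fixed lattices of a torus element).
* [Serre1980Trees] J.-P. Serre, *Trees*, Springer (1980), Ch. II §1.1 (lattices, Hermite normal form, the diagonal action).
-/

set_option autoImplicit false

noncomputable section

namespace Summit.HodgeConjecture.HodgeConjecture.Cruxes.H413.F0P3cDyRamDiagonalGluedStabilityCorner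

open Matrix
open Literature.NumberTheory.Automorphic Literature.NumberTheory.Automorphic.HermitianLattice Literature.NumberTheory.Automorphic.UnitaryGroup
open Literature.NumberTheory.Automorphic.UnitaryLatticeTree
open Summit.HodgeConjecture.HodgeConjecture.Cruxes.H413.F0P3cDyRamDiagonalGluedStability
open scoped Valued WithZero Matrix MatrixGroups

variable {K : Type*} [Field K] [Valued K ℤᵐ⁰]

/-- **THE THREE STABILITY CONGRUENCES AT A GENERAL CORNER** (★ p855795 `mapGL_latt_hnf_glued_eq_iff` re-keyed on the corner `2ρ + s + e`):
`T·latt V = latt V ↔ |(β−α)x| ≤ |ϖ|^ρ ∧ |(β−1)ζ| ≤ |ϖ|^{ρ+s+e} ∧ |(β−1)xζ + (α−1)y″| ≤ |ϖ|^{2ρ+s+e}`. [cite: Kottwitz1986BaseChangeUnits, §1 pp. 240–241] [cite: Serre1980Trees, Ch. II §1.1] -/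
theorem mapGL_latt_hnf_glued_corner_eq_iff {ϖ : K} (hϖ : ϖ ≠ 0) {α β : K} (hα : Valued.v α = 1) (hβ : Valued.v β = 1) (T : GL (Fin 3) K)
    (hT : (T : Matrix (Fin 3) (Fin 3) K) = Matrix.diagonal ![α, β, 1]) (ρ s e : ℕ) (x ζ y'' : K) (V : GL (Fin 3) K)
    (hV : (V : Matrix (Fin 3) (Fin 3) K) = !![1, 0, 0; x, ϖ ^ ρ, 0; x * ζ + y'', ϖ ^ ρ * ζ, ϖ ^ (2 * ρ + s + e)]) :
    mapGL T (latt (V : Matrix (Fin 3) (Fin 3) K)) = latt (V : Matrix (Fin 3) (Fin 3) K) ↔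
      Valued.v ((β - α) * x) ≤ Valued.v ϖ ^ ρ ∧ Valued.v ((β - 1) * ζ) ≤ Valued.v ϖ ^ (ρ + s + e) ∧
        Valued.v ((β - 1) * x * ζ + (α - 1) * y'') ≤ Valued.v ϖ ^ (2 * ρ + s + e) := by
  have hV' : (V : Matrix (Fin 3) (Fin 3) K) = !![1, 0, 0; x, ϖ ^ ρ, 0; x * ζ + y'', ϖ ^ ρ * ζ, ϖ ^ (2 * ρ + (s + e))] := by
    rw [hV, Nat.add_assoc]
  rw [mapGL_latt_hnf_glued_eq_iff hϖ hα hβ T hT ρ (s + e) x ζ y'' V hV', ← Nat.add_assoc, ← Nat.add_assoc]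

/-- **TUBE ⟹ STABLE AT A GENERAL CORNER, point-free**: `|β−1| = |ϖ|^{n₁}`, `|α−1| = |ϖ|^{n₂}`, `|β−α| = |ϖ|^{n₃}` with `2ρ + s + e ≤ n₁`, `2ρ + e ≤ n₂`, `ρ ≤ n₃` ⟹ EVERY point
of the glued stratum (`|x| = |ζ| = 1`, `|y″| = |ϖ|^s`, corner `2ρ+s+e`) is `T`-stable. [cite: Kottwitz1986BaseChangeUnits, §1 pp. 240–241] -/
theorem mapGL_latt_hnf_glued_corner_eq_of_depths {ϖ : K} (hϖ : ϖ ≠ 0) (hϖ1 : Valued.v ϖ ≤ 1) {α β : K} (hα : Valued.v α = 1) (hβ : Valued.v β = 1)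
    (T : GL (Fin 3) K) (hT : (T : Matrix (Fin 3) (Fin 3) K) = Matrix.diagonal ![α, β, 1]) {n₁ n₂ n₃ : ℕ}
    (h₁ : Valued.v (β - 1) = Valued.v ϖ ^ n₁) (h₂ : Valued.v (α - 1) = Valued.v ϖ ^ n₂) (h₃ : Valued.v (β - α) = Valued.v ϖ ^ n₃)
    (ρ s e : ℕ) (hρ₁ : 2 * ρ + s + e ≤ n₁) (hρ₂ : 2 * ρ + e ≤ n₂) (hρ₃ : ρ ≤ n₃) {x ζ y'' : K} (hx : Valued.v x = 1) (hζ : Valued.v ζ = 1)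
    (hy'' : Valued.v y'' = Valued.v ϖ ^ s) (V : GL (Fin 3) K)
    (hV : (V : Matrix (Fin 3) (Fin 3) K) = !![1, 0, 0; x, ϖ ^ ρ, 0; x * ζ + y'', ϖ ^ ρ * ζ, ϖ ^ (2 * ρ + s + e)]) :
    mapGL T (latt (V : Matrix (Fin 3) (Fin 3) K)) = latt (V : Matrix (Fin 3) (Fin 3) K) := by
  have hle : ∀ {m n : ℕ}, m ≤ n → Valued.v ϖ ^ n ≤ Valued.v ϖ ^ m := fun h => pow_le_pow_right_of_le_one' hϖ1 h
  rw [mapGL_latt_hnf_glued_corner_eq_iff hϖ hα hβ T hT ρ s e x ζ y'' V hV]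
  refine ⟨?_, ?_, ?_⟩
  · rw [map_mul, hx, mul_one, h₃]; exact hle hρ₃
  · rw [map_mul, hζ, mul_one, h₁]; exact hle (by omega)
  · refine (Valuation.map_add _ _ _).trans (max_le ?_ ?_)
    · rw [map_mul, map_mul, hx, hζ, mul_one, mul_one, h₁]; exact hle hρ₁
    · rw [map_mul, h₂, hy'', ← pow_add]; exact hle (by omega)

/-- **OFF THE GLUE FOOT, STABLE ⟹ TUBE, general corner**: if `n₁ ≠ n₂ + s` then stability of a point of the glued stratum (`|x| = |ζ| = 1`, `|y″| = |ϖ|^s`, corner `2ρ+s+e`)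
forces `2ρ + s + e ≤ n₁` and `2ρ + e ≤ n₂`. [cite: Kottwitz1986BaseChangeUnits, §1 pp. 240–241] -/
theorem depths_of_mapGL_latt_hnf_glued_corner_eq {ϖ : K} (hϖ : ϖ ≠ 0) (hϖ1 : Valued.v ϖ < 1) {α β : K} (hα : Valued.v α = 1) (hβ : Valued.v β = 1)
    (T : GL (Fin 3) K) (hT : (T : Matrix (Fin 3) (Fin 3) K) = Matrix.diagonal ![α, β, 1]) {n₁ n₂ : ℕ}
    (h₁ : Valued.v (β - 1) = Valued.v ϖ ^ n₁) (h₂ : Valued.v (α - 1) = Valued.v ϖ ^ n₂)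
    (ρ s e : ℕ) (hne : n₁ ≠ n₂ + s) {x ζ y'' : K} (hx : Valued.v x = 1) (hζ : Valued.v ζ = 1)
    (hy'' : Valued.v y'' = Valued.v ϖ ^ s) (V : GL (Fin 3) K)
    (hV : (V : Matrix (Fin 3) (Fin 3) K) = !![1, 0, 0; x, ϖ ^ ρ, 0; x * ζ + y'', ϖ ^ ρ * ζ, ϖ ^ (2 * ρ + s + e)])
    (hstab : mapGL T (latt (V : Matrix (Fin 3) (Fin 3) K)) = latt (V : Matrix (Fin 3) (Fin 3) K)) :
    2 * ρ + s + e ≤ n₁ ∧ 2 * ρ + e ≤ n₂ := by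
  have hvϖ : 0 < Valued.v ϖ := (Valuation.pos_iff _).2 hϖ
  have hinj : ∀ {m n : ℕ}, Valued.v ϖ ^ m ≤ Valued.v ϖ ^ n → n ≤ m := fun {m n} h => by
    by_contra hlt; rw [not_le] at hlt
    exact absurd h (not_le.2 (pow_lt_pow_right_of_lt_one₀ hvϖ hϖ1 hlt))
  obtain ⟨-, -, h3⟩ := (mapGL_latt_hnf_glued_corner_eq_iff hϖ hα hβ T hT ρ s e x ζ y'' V hV).1 hstab
  have hva : Valued.v ((β - 1) * x * ζ) = Valued.v ϖ ^ n₁ := by rw [map_mul, map_mul, h₁, hx, hζ, mul_one, mul_one]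
  have hvb : Valued.v ((α - 1) * y'') = Valued.v ϖ ^ (n₂ + s) := by rw [map_mul, h₂, hy'', pow_add]
  have hne' : Valued.v ((β - 1) * x * ζ) ≠ Valued.v ((α - 1) * y'') := by
    rw [hva, hvb]
    exact fun h => hne (pow_right_injective₀ hvϖ hϖ1.ne h)
  obtain ⟨ha, hb⟩ := v_le_and_v_le_of_v_add_le_of_ne hne' h3
  rw [hva] at ha
  rw [hvb] at hb
  exact ⟨hinj ha, by have := hinj hb; omega⟩

/-- **ON THE GLUE FOOT** (`n₁ = n₂ + s`, hence the two (S3)-terms have the same valuation and may cancel): a point of the glued stratum is `T`-stable iff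
`ρ ≤ n₃ ∧ ρ + s + e ≤ n₁ ∧ |(β−1)xζ + (α−1)y″| ≤ |ϖ|^{2ρ+s+e}` (the first two congruences read off the depths, the GLUE congruence kept verbatim for ★ B6's coset count).
[cite: Kottwitz1986BaseChangeUnits, §1 pp. 240–241] -/
theorem mapGL_latt_hnf_glued_corner_eq_iff_depths {ϖ : K} (hϖ : ϖ ≠ 0) (hϖ1 : Valued.v ϖ < 1) {α β : K} (hα : Valued.v α = 1) (hβ : Valued.v β = 1)
    (T : GL (Fin 3) K) (hT : (T : Matrix (Fin 3) (Fin 3) K) = Matrix.diagonal ![α, β, 1]) {n₁ n₃ : ℕ}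
    (h₁ : Valued.v (β - 1) = Valued.v ϖ ^ n₁) (h₃ : Valued.v (β - α) = Valued.v ϖ ^ n₃)
    (ρ s e : ℕ) {x ζ y'' : K} (hx : Valued.v x = 1) (hζ : Valued.v ζ = 1) (V : GL (Fin 3) K)
    (hV : (V : Matrix (Fin 3) (Fin 3) K) = !![1, 0, 0; x, ϖ ^ ρ, 0; x * ζ + y'', ϖ ^ ρ * ζ, ϖ ^ (2 * ρ + s + e)]) :
    mapGL T (latt (V : Matrix (Fin 3) (Fin 3) K)) = latt (V : Matrix (Fin 3) (Fin 3) K) ↔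
      ρ ≤ n₃ ∧ ρ + s + e ≤ n₁ ∧ Valued.v ((β - 1) * x * ζ + (α - 1) * y'') ≤ Valued.v ϖ ^ (2 * ρ + s + e) := by
  have hvϖ : 0 < Valued.v ϖ := (Valuation.pos_iff _).2 hϖ
  have hiff : ∀ {m n : ℕ}, Valued.v ϖ ^ m ≤ Valued.v ϖ ^ n ↔ n ≤ m := fun {m n} => pow_le_pow_iff_right_of_lt_one₀ hvϖ hϖ1
  rw [mapGL_latt_hnf_glued_corner_eq_iff hϖ hα hβ T hT ρ s e x ζ y'' V hV, map_mul, hx, mul_one, h₃, hiff, map_mul, hζ, mul_one, h₁, hiff]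

/-- **TYPE 2, TUBE ⟹ STABLE** (MEMO v2.1 §T2.3, `G₁(2ρ+1, s)`, corner `2ρ + 1 + s`): `2ρ + 1 + s ≤ n₁`, `2ρ + 1 ≤ n₂`, `ρ ≤ n₃` ⟹ every point is `T`-stable.
[cite: Kottwitz1986BaseChangeUnits, §1 pp. 240–241] -/
theorem mapGL_latt_hnf_glued_typeTwo_eq_of_depths {ϖ : K} (hϖ : ϖ ≠ 0) (hϖ1 : Valued.v ϖ ≤ 1) {α β : K} (hα : Valued.v α = 1) (hβ : Valued.v β = 1)
    (T : GL (Fin 3) K) (hT : (T : Matrix (Fin 3) (Fin 3) K) = Matrix.diagonal ![α, β, 1]) {n₁ n₂ n₃ : ℕ}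
    (h₁ : Valued.v (β - 1) = Valued.v ϖ ^ n₁) (h₂ : Valued.v (α - 1) = Valued.v ϖ ^ n₂) (h₃ : Valued.v (β - α) = Valued.v ϖ ^ n₃)
    (ρ s : ℕ) (hρ₁ : 2 * ρ + 1 + s ≤ n₁) (hρ₂ : 2 * ρ + 1 ≤ n₂) (hρ₃ : ρ ≤ n₃) {x ζ y'' : K} (hx : Valued.v x = 1) (hζ : Valued.v ζ = 1)
    (hy'' : Valued.v y'' = Valued.v ϖ ^ s) (V : GL (Fin 3) K)
    (hV : (V : Matrix (Fin 3) (Fin 3) K) = !![1, 0, 0; x, ϖ ^ ρ, 0; x * ζ + y'', ϖ ^ ρ * ζ, ϖ ^ (2 * ρ + 1 + s)]) :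
    mapGL T (latt (V : Matrix (Fin 3) (Fin 3) K)) = latt (V : Matrix (Fin 3) (Fin 3) K) := by
  have hV1 : (V : Matrix (Fin 3) (Fin 3) K) = !![1, 0, 0; x, ϖ ^ ρ, 0; x * ζ + y'', ϖ ^ ρ * ζ, ϖ ^ (2 * ρ + s + 1)] := by
    rw [hV, show 2 * ρ + 1 + s = 2 * ρ + s + 1 by ring]
  exact mapGL_latt_hnf_glued_corner_eq_of_depths hϖ hϖ1 hα hβ T hT h₁ h₂ h₃ ρ s 1 (by omega) (by omega) hρ₃ hx hζ hy'' V hV1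

/-- **TYPE 2, OFF THE GLUE FOOT, STABLE ⟹ TUBE**: `n₁ ≠ n₂ + s` and `T·latt V = latt V` on `G₁(2ρ+1, s)` ⟹ `2ρ + 1 + s ≤ n₁ ∧ 2ρ + 1 ≤ n₂`.
[cite: Kottwitz1986BaseChangeUnits, §1 pp. 240–241] -/
theorem depths_of_mapGL_latt_hnf_glued_typeTwo_eq {ϖ : K} (hϖ : ϖ ≠ 0) (hϖ1 : Valued.v ϖ < 1) {α β : K} (hα : Valued.v α = 1) (hβ : Valued.v β = 1)
    (T : GL (Fin 3) K) (hT : (T : Matrix (Fin 3) (Fin 3) K) = Matrix.diagonal ![α, β, 1]) {n₁ n₂ : ℕ}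
    (h₁ : Valued.v (β - 1) = Valued.v ϖ ^ n₁) (h₂ : Valued.v (α - 1) = Valued.v ϖ ^ n₂)
    (ρ s : ℕ) (hne : n₁ ≠ n₂ + s) {x ζ y'' : K} (hx : Valued.v x = 1) (hζ : Valued.v ζ = 1)
    (hy'' : Valued.v y'' = Valued.v ϖ ^ s) (V : GL (Fin 3) K)
    (hV : (V : Matrix (Fin 3) (Fin 3) K) = !![1, 0, 0; x, ϖ ^ ρ, 0; x * ζ + y'', ϖ ^ ρ * ζ, ϖ ^ (2 * ρ + 1 + s)])
    (hstab : mapGL T (latt (V : Matrix (Fin 3) (Fin 3) K)) = latt (V : Matrix (Fin 3) (Fin 3) K)) :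
    2 * ρ + 1 + s ≤ n₁ ∧ 2 * ρ + 1 ≤ n₂ := by
  have hV1 : (V : Matrix (Fin 3) (Fin 3) K) = !![1, 0, 0; x, ϖ ^ ρ, 0; x * ζ + y'', ϖ ^ ρ * ζ, ϖ ^ (2 * ρ + s + 1)] := by
    rw [hV, show 2 * ρ + 1 + s = 2 * ρ + s + 1 by ring]
  have h := depths_of_mapGL_latt_hnf_glued_corner_eq hϖ hϖ1 hα hβ T hT h₁ h₂ ρ s 1 hne hx hζ hy'' V hV1 hstab
  omega

end Summit.HodgeConjecture.HodgeConjecture.Cruxes.H413.F0P3cDyRamDiagonalGluedStabilityCorner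

end
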